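import Mathlib
import HarnessLib

/-!
# The Subspace Theorem over `ℚ` — I. Congruence lattices at the finite places

Towards a proof of the `p`-adic Subspace Theorem over `ℚ` (W. M. Schmidt 1972 for `S = {∞}`,
H. P. Schlickewei 1977 with finitely many places; E. Bombieri, W. Gubler, *Heights in Diophantine
Geometry* (2006) [BombieriGubler2006], Thm. 7.2.2 / Cor. 7.2.5, proof in §7.5) in the special case
`K = ℚ`, rational linear forms, integer points — the hypothesis `hST` of
`Literature.NumberTheory.DiophantineGeometry.BugeaudCorvajaZannier2003_thm1_of_subspaceTheorem`.
We follow B–G §7.5 (Schmidt's proof with Schlickewei's and Evertse's modifications), specialised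
to `K = ℚ`; this file is the part of **Step 0 / 7.5.6–7.5.7** that lives at the finite places.
Throughout the proof the linear forms at a finite place `p` are taken with INTEGER coefficient
vectors (an integer matrix `M_p` with `det M_p ≠ 0`; the reduction of rational forms to this case,
by clearing denominators, costs a constant factor and is part of Step 0).

For `K = ℚ` the non-archimedean factors `Π_p(Q) = {ξ : |M_{p,i}(ξ)|_p ≤ Q^{c_{p,i}}}` of B–G's
approximation domain `Π(Q)` (7.5.6), cut out on `ℤ^ι` the **congruence lattice**
`Λ = {x ∈ ℤ^ι : p^{a_{p,i}} ∣ M_{p,i}(x) for all p ∈ S, i}` (`|y|_p ≤ p^{-a} ⇔ p^a ∣ y` for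
integers `y`), a subgroup of finite index of `ℤ^ι`, and B–G's volume formula Lemma 7.5.7 (b)
becomes the two-sided index estimate
`∏_{p∈S} (∏_i p^{a_{p,i}}) / |det M_p|^{card ι} ≤ [ℤ^ι : Λ] ≤ ∏_{p∈S} ∏_i p^{a_{p,i}}`,
proved by reducing modulo `p^{a_{p,i}}` (`x ↦ (M_{p,i}(x) mod p^{a_{p,i}})_i` has kernel `Λ_p` and
image of size at most `∏_i p^{a_{p,i}}` and, by the adjugate identity `M adj(M) = det M`, at least
`∏_i p^{a_{p,i}} / |det M_p|^{card ι}`) and multiplying over `p ∈ S` (the indices of the `Λ_p` are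
powers of the distinct primes `p`).

Main definitions / results (namespace `Literature.NumberTheory.DiophantineApproximation.Subspace`):
* `localLattice p M a`, `lattice S M a` — the congruence lattices, `AddSubgroup (ι → ℤ)`;
* `mem_localLattice_iff_padicNorm` — membership as the `p`-adic inequalities of B–G;
* `index_localLattice_le`, `prod_pow_le_index_localLattice`, `index_lattice_le`,
  `prod_pow_le_index_lattice` — Lemma 7.5.7 (b) for `K = ℚ` as index bounds.

## References
* [BombieriGubler2006] E. Bombieri, W. Gubler, *Heights in Diophantine Geometry*, CUP 2006,
  §7.5 (7.5.6, Lemma 7.5.7).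
* [Schmidt1972] W. M. Schmidt, *Norm form equations*, Ann. of Math. 96 (1972), 526–551.
* [Schlickewei1977] H. P. Schlickewei, *The 𝔭-adic Thue–Siegel–Roth–Schmidt theorem*,
  Arch. Math. 29 (1977), 267–270.
-/

noncomputable section

open Finset Matrix

namespace Literature.NumberTheory.DiophantineApproximation.Subspace

variable {ι : Type*} [Fintype ι]

/-! ### The local congruence lattice at a prime `p` -/

/-- The local congruence lattice `Λ_p = {x ∈ ℤ^ι : p^{a_i} ∣ M_i(x) ∀ i}` of the integer forms
`M_i(x) = Σ_j M_{ij} x_j` (the rows of `M`) with exponents `a`, as a subgroup of `ℤ^ι`: the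
integer points of the `p`-adic factor `{|M_i(ξ)|_p ≤ p^{-a_i}}` of an approximation domain.
[cite: BombieriGubler2006, 7.5.6] -/
def localLattice (p : ℕ) (M : Matrix ι ι ℤ) (a : ι → ℕ) : AddSubgroup (ι → ℤ) where
  carrier := {x | ∀ i, (p : ℤ) ^ (a i) ∣ (M *ᵥ x) i}
  zero_mem' := fun i => by simp
  add_mem' := by
    intro x y hx hy i
    rw [mulVec_add, Pi.add_apply]
    exact dvd_add (hx i) (hy i)
  neg_mem' := by
    intro x hx i
    rw [mulVec_neg, Pi.neg_apply]
    exact (dvd_neg).mpr (hx i)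

/-- Membership in `Λ_p`: the divisibilities `p^{a_i} ∣ M_i(x)`. [folklore] -/
theorem mem_localLattice {p : ℕ} {M : Matrix ι ι ℤ} {a : ι → ℕ} {x : ι → ℤ} :
    x ∈ localLattice p M a ↔ ∀ i, (p : ℤ) ^ (a i) ∣ (M *ᵥ x) i := Iff.rfl

/-- Membership in `Λ_p` as B–G write it: `|M_i(x)|_p ≤ p^{-a_i}` for all `i`.
[cite: BombieriGubler2006, 7.5.6] -/
theorem mem_localLattice_iff_padicNorm {p : ℕ} [Fact p.Prime] {M : Matrix ι ι ℤ} {a : ι → ℕ}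
    {x : ι → ℤ} :
    x ∈ localLattice p M a ↔ ∀ i, padicNorm p ((M *ᵥ x) i : ℤ) ≤ (p : ℚ) ^ (-(a i : ℤ)) := by
  refine forall_congr' fun i => ?_
  rw [← padicNorm.dvd_iff_norm_le]
  push_cast
  rfl

/-- The reduction map `x ↦ (M_i(x) mod p^{a_i})_i`. [cite: BombieriGubler2006, Lemma 7.5.7] -/
def reduceHom (p : ℕ) (M : Matrix ι ι ℤ) (a : ι → ℕ) : (ι → ℤ) →+ ((i : ι) → ZMod (p ^ a i)) where
  toFun x i := (((M *ᵥ x) i : ℤ) : ZMod (p ^ a i))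
  map_zero' := by ext i; simp
  map_add' x y := by ext i; simp [mulVec_add]

/-- Unfolding lemma for `reduceHom`. [folklore] -/
theorem reduceHom_apply (p : ℕ) (M : Matrix ι ι ℤ) (a : ι → ℕ) (x : ι → ℤ) (i : ι) :
    reduceHom p M a x i = (((M *ᵥ x) i : ℤ) : ZMod (p ^ a i)) := rfl

/-- The kernel of the reduction map is `Λ_p`. [cite: BombieriGubler2006, Lemma 7.5.7] -/
theorem ker_reduceHom (p : ℕ) (M : Matrix ι ι ℤ) (a : ι → ℕ) :
    (reduceHom p M a).ker = localLattice p M a := by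
  ext x
  rw [AddMonoidHom.mem_ker, mem_localLattice, funext_iff]
  refine forall_congr' fun i => ?_
  rw [Pi.zero_apply, reduceHom_apply, ZMod.intCast_zmod_eq_zero_iff_dvd]
  push_cast
  rfl

/-- `Λ_p` has finite index, at most `∏_i p^{a_i}` (for `p ≥ 1`).
[cite: BombieriGubler2006, Lemma 7.5.7 (b)] -/
theorem index_localLattice_le (p : ℕ) (hp : 0 < p) (M : Matrix ι ι ℤ) (a : ι → ℕ) :
    (localLattice p M a).index ≤ ∏ i, p ^ a i := by
  haveI : ∀ i, NeZero (p ^ a i) := fun i => ⟨(pow_pos hp _).ne'⟩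
  rw [← ker_reduceHom, AddSubgroup.index_ker]
  calc Nat.card (reduceHom p M a).range
      ≤ Nat.card ((i : ι) → ZMod (p ^ a i)) :=
        Nat.card_le_card_of_injective _ Subtype.val_injective
    _ = ∏ i, p ^ a i := by simp [Nat.card_pi]

/-- `Λ_p` has finite (i.e. non-zero) index. [folklore] -/
theorem index_localLattice_ne_zero (p : ℕ) (hp : 0 < p) (M : Matrix ι ι ℤ) (a : ι → ℕ) :
    (localLattice p M a).index ≠ 0 := by
  haveI : ∀ i, NeZero (p ^ a i) := fun i => ⟨(pow_pos hp _).ne'⟩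
  rw [← ker_reduceHom, AddSubgroup.index_ker]
  haveI : Finite (reduceHom p M a).range := inferInstance
  exact Nat.card_pos.ne'

/-- The index of `Λ_p` divides `∏_i p^{a_i}`; in particular it is a power of `p` when `p` is
prime. [folklore] -/
theorem index_localLattice_dvd (p : ℕ) (hp : 0 < p) (M : Matrix ι ι ℤ) (a : ι → ℕ) :
    (localLattice p M a).index ∣ ∏ i, p ^ a i := by
  haveI : ∀ i, NeZero (p ^ a i) := fun i => ⟨(pow_pos hp _).ne'⟩
  rw [← ker_reduceHom, AddSubgroup.index_ker]
  have h := (reduceHom p M a).range.card_addSubgroup_dvd_card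
  simpa [Nat.card_pi, Nat.card_zmod] using h

/-- For a prime `p` the index of `Λ_p` is a power of `p`. [folklore] -/
theorem index_localLattice_eq_pow (p : ℕ) (hp : p.Prime) (M : Matrix ι ι ℤ) (a : ι → ℕ) :
    ∃ k : ℕ, (localLattice p M a).index = p ^ k := by
  have h := index_localLattice_dvd p hp.pos M a
  rw [Finset.prod_pow_eq_pow_sum] at h
  exact (Nat.dvd_prime_pow hp).mp h |>.imp fun k hk => hk.2

/-! ### The lower bound for the index of `Λ_p` -/

section LowerBound

variable [DecidableEq ι]

/-- The adjugate identity at a vector: `M (adj M y) = (det M) y`. [folklore] -/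
theorem mulVec_adjugate_mulVec (M : Matrix ι ι ℤ) (y : ι → ℤ) :
    M *ᵥ (M.adjugate *ᵥ y) = M.det • y := by
  rw [mulVec_mulVec, mul_adjugate, smul_mulVec, one_mulVec]

/-- The order of `δ` in `ZMod n` times `|δ|` is at least `n` (`δ ≠ 0`, `n ≠ 0`): indeed the order
is `n / gcd(n, |δ|)` and `gcd(n, |δ|) ≤ |δ|`. [folklore] -/
theorem le_natAbs_mul_addOrderOf (n : ℕ) (hn : n ≠ 0) (δ : ℤ) (hδ : δ ≠ 0) :
    n ≤ δ.natAbs * addOrderOf ((δ : ℤ) : ZMod n) := by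
  set m : ℕ := δ.natAbs with hm
  have hm0 : 0 < m := Int.natAbs_pos.mpr hδ
  have hord : addOrderOf ((δ : ℤ) : ZMod n) = n / n.gcd m := by
    rcases Int.natAbs_eq δ with h | h
    · rw [← hm] at h
      rw [h, Int.cast_natCast, ZMod.addOrderOf_coe _ hn]
    · rw [← hm] at h
      rw [h, Int.cast_neg, Int.cast_natCast, addOrderOf_neg, ZMod.addOrderOf_coe _ hn]
  rw [hord]
  have hg : n.gcd m ≤ m := Nat.le_of_dvd hm0 (Nat.gcd_dvd_right _ _)
  calc n = n.gcd m * (n / n.gcd m) := (Nat.mul_div_cancel' (Nat.gcd_dvd_left _ _)).symm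
    _ ≤ m * (n / n.gcd m) := Nat.mul_le_mul_right _ hg

/-- **Lower bound for the index of `Λ_p`** (B–G Lemma 7.5.7 (b), `K = ℚ`, as an inequality):
`∏_i p^{a_i} ≤ |det M|^{card ι} · [ℤ^ι : Λ_p]`. The image of the reduction map contains, by the
adjugate identity, all vectors `((det M) y_i mod p^{a_i})_i`, a subgroup of order
`∏_i p^{a_i}/gcd(p^{a_i}, det M) ≥ ∏_i p^{a_i} / |det M|^{card ι}`.
[cite: BombieriGubler2006, Lemma 7.5.7 (b)] -/
theorem prod_pow_le_index_localLattice (p : ℕ) (hp : 0 < p) (M : Matrix ι ι ℤ)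
    (hM : M.det ≠ 0) (a : ι → ℕ) :
    ∏ i, p ^ a i ≤ M.det.natAbs ^ Fintype.card ι * (localLattice p M a).index := by
  haveI : ∀ i, NeZero (p ^ a i) := fun i => ⟨(pow_pos hp _).ne'⟩
  -- the subgroups `ℤ δ ⊂ ZMod (p^{a_i})` and the injection of their product into the image
  set δ : ℤ := M.det with hδ
  let H : (i : ι) → AddSubgroup (ZMod (p ^ a i)) :=
    fun i => AddSubgroup.zmultiples ((δ : ℤ) : ZMod (p ^ a i))
  have hmem : ∀ g : (i : ι) → H i, (fun i => (g i : ZMod (p ^ a i))) ∈ (reduceHom p M a).range := by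
    intro g
    have hg : ∀ i, ∃ k : ℤ, k • ((δ : ℤ) : ZMod (p ^ a i)) = (g i : ZMod (p ^ a i)) :=
      fun i => AddSubgroup.mem_zmultiples_iff.mp (g i).2
    choose k hk using hg
    refine ⟨M.adjugate *ᵥ k, ?_⟩
    funext i
    rw [reduceHom_apply, mulVec_adjugate_mulVec, Pi.smul_apply, smul_eq_mul, ← hk i,
      zsmul_eq_mul, Int.cast_mul, mul_comm]
  let F : ((i : ι) → H i) → (reduceHom p M a).range := fun g => ⟨_, hmem g⟩
  have hF : Function.Injective F := by
    intro g g' h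
    have h' := congrArg Subtype.val h
    funext i
    exact Subtype.ext (congrFun h' i)
  have hcard : ∏ i, Nat.card (H i) ≤ (localLattice p M a).index := by
    rw [← ker_reduceHom, AddSubgroup.index_ker, ← Nat.card_pi]
    exact Nat.card_le_card_of_injective F hF
  calc ∏ i, p ^ a i ≤ ∏ i, δ.natAbs * Nat.card (H i) := by
        refine Finset.prod_le_prod' fun i _ => ?_
        rw [Nat.card_zmultiples]
        exact le_natAbs_mul_addOrderOf _ (NeZero.ne _) δ hM
    _ = δ.natAbs ^ Fintype.card ι * ∏ i, Nat.card (H i) := by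
        rw [Finset.prod_mul_distrib, Finset.prod_const, Finset.card_univ]
    _ ≤ δ.natAbs ^ Fintype.card ι * (localLattice p M a).index := Nat.mul_le_mul_left _ hcard

end LowerBound

/-! ### The global congruence lattice for a finite set of primes -/

/-- The congruence lattice `Λ = {x ∈ ℤ^ι : p^{a_{p,i}} ∣ M_{p,i}(x) ∀ p ∈ S, ∀ i}` for a finite
set `S` of primes, integer forms `M_p` and exponents `a_p` (`p ∈ S`).
[cite: BombieriGubler2006, 7.5.6] -/
def lattice (S : Finset ℕ) (M : ℕ → Matrix ι ι ℤ) (a : ℕ → ι → ℕ) : AddSubgroup (ι → ℤ) where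
  carrier := {x | ∀ p ∈ S, x ∈ localLattice p (M p) (a p)}
  zero_mem' := fun p _ => (localLattice p (M p) (a p)).zero_mem
  add_mem' := fun hx hy p hp => (localLattice p (M p) (a p)).add_mem (hx p hp) (hy p hp)
  neg_mem' := fun hx p hp => (localLattice p (M p) (a p)).neg_mem (hx p hp)

/-- Membership in `Λ`: the divisibilities `p^{a_{p,i}} ∣ M_{p,i}(x)`, `p ∈ S`. [folklore] -/
theorem mem_lattice {S : Finset ℕ} {M : ℕ → Matrix ι ι ℤ} {a : ℕ → ι → ℕ} {x : ι → ℤ} :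
    x ∈ lattice S M a ↔ ∀ p ∈ S, ∀ i, (p : ℤ) ^ (a p i) ∣ (M p *ᵥ x) i := Iff.rfl

/-- The global lattice is the infimum of the local ones over `p ∈ S`. [folklore] -/
theorem lattice_eq_iInf (S : Finset ℕ) (M : ℕ → Matrix ι ι ℤ) (a : ℕ → ι → ℕ) :
    lattice S M a = ⨅ p : S, localLattice (ι := ι) p.1 (M p.1) (a p.1) := by
  ext x
  simp only [AddSubgroup.mem_iInf, Subtype.forall]
  rfl

/-- `Λ ≤ Λ_p` for `p ∈ S`. [folklore] -/
theorem lattice_le_localLattice (S : Finset ℕ) (M : ℕ → Matrix ι ι ℤ) (a : ℕ → ι → ℕ) {p : ℕ}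
    (hp : p ∈ S) : lattice S M a ≤ localLattice p (M p) (a p) :=
  fun _ hx => hx p hp

/-- **Upper bound for the index of `Λ`**: `[ℤ^ι : Λ] ≤ ∏_{p∈S} ∏_i p^{a_{p,i}}` (all `p ∈ S`
positive). [cite: BombieriGubler2006, Lemma 7.5.7 (b)] -/
theorem index_lattice_le (S : Finset ℕ) (hS : ∀ p ∈ S, 0 < p) (M : ℕ → Matrix ι ι ℤ)
    (a : ℕ → ι → ℕ) : (lattice S M a).index ≤ ∏ p ∈ S, ∏ i, p ^ a p i := by
  rw [lattice_eq_iInf]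
  refine (AddSubgroup.index_iInf_le _).trans ?_
  rw [← Finset.prod_coe_sort S]
  exact Finset.prod_le_prod' fun p _ => index_localLattice_le p.1 (hS p.1 p.2) (M p.1) (a p.1)

/-- `Λ` has finite (non-zero) index. [folklore] -/
theorem index_lattice_ne_zero (S : Finset ℕ) (hS : ∀ p ∈ S, 0 < p) (M : ℕ → Matrix ι ι ℤ)
    (a : ℕ → ι → ℕ) : (lattice S M a).index ≠ 0 := by
  rw [lattice_eq_iInf]
  exact AddSubgroup.index_iInf_ne_zero fun p => index_localLattice_ne_zero p.1 (hS p.1 p.2) _ _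

/-- The product of the indices of the local lattices divides the index of `Λ` (they are powers of
the distinct primes `p ∈ S`). [folklore] -/
theorem prod_index_localLattice_dvd (S : Finset ℕ) (hS : ∀ p ∈ S, p.Prime) (M : ℕ → Matrix ι ι ℤ)
    (a : ℕ → ι → ℕ) :
    ∏ p ∈ S, (localLattice p (M p) (a p)).index ∣ (lattice S M a).index := by
  -- work in `ℤ`, where `IsCoprime` is the usual coprimality
  suffices h : ∏ p ∈ S, ((localLattice p (M p) (a p)).index : ℤ) ∣ ((lattice S M a).index : ℤ) by
    rw [← Nat.cast_prod] at h
    exact Int.natCast_dvd_natCast.mp h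
  refine Finset.prod_dvd_of_coprime ?_ fun p hp => ?_
  · intro p hp q hq hpq
    obtain ⟨k, hk⟩ := index_localLattice_eq_pow p (hS p hp) (M p) (a p)
    obtain ⟨l, hl⟩ := index_localLattice_eq_pow q (hS q hq) (M q) (a q)
    simp only [Function.onFun, hk, hl]
    exact Nat.isCoprime_iff_coprime.mpr
      (Nat.Coprime.pow _ _ ((Nat.coprime_primes (hS p hp) (hS q hq)).mpr hpq))
  · exact Int.natCast_dvd_natCast.mpr
      (AddSubgroup.index_dvd_of_le (lattice_le_localLattice S M a hp))

/-- **Lower bound for the index of `Λ`**: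
`∏_{p∈S} ∏_i p^{a_{p,i}} ≤ (∏_{p∈S} |det M_p|^{card ι}) · [ℤ^ι : Λ]`.
[cite: BombieriGubler2006, Lemma 7.5.7 (b)] -/
theorem prod_pow_le_index_lattice [DecidableEq ι] (S : Finset ℕ) (hS : ∀ p ∈ S, p.Prime)
    (M : ℕ → Matrix ι ι ℤ) (hM : ∀ p ∈ S, (M p).det ≠ 0) (a : ℕ → ι → ℕ) :
    ∏ p ∈ S, ∏ i, p ^ a p i ≤
      (∏ p ∈ S, (M p).det.natAbs ^ Fintype.card ι) * (lattice S M a).index := by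
  have h1 : ∏ p ∈ S, ∏ i, p ^ a p i ≤
      ∏ p ∈ S, ((M p).det.natAbs ^ Fintype.card ι * (localLattice p (M p) (a p)).index) :=
    Finset.prod_le_prod' fun p hp => prod_pow_le_index_localLattice p (hS p hp).pos _ (hM p hp) _
  refine h1.trans ?_
  rw [Finset.prod_mul_distrib]
  refine Nat.mul_le_mul_left _ (Nat.le_of_dvd ?_ (prod_index_localLattice_dvd S hS M a))
  exact Nat.pos_of_ne_zero (index_lattice_ne_zero S (fun p hp => (hS p hp).pos) M a)

end Literature.NumberTheory.DiophantineApproximation.Subspace
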